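import Summits.Ventures.CertifiedArithmetic.LowPrec.GemmEnvelopeRowsB
import Summits.Ventures.CertifiedArithmetic.LowPrec.Monotone

/-!
# GEMM-level envelopes, part (f): row P5 and its exact crossover (pub-lowprec gemm gen 22, LXX-f)

HONEST FRAMING: certified error envelopes and provably optimal rounding/accumulation schemes for
low-precision formats under stated cost models; every table by two implementations; no hardware or
vendor claims.

Row P5 of the decision table compares MX-E4M3 (ceil scale) with per-vector E4M3 on the class `C(κ)`
beyond `κ = 14336`, where a scaled MX element may leave the normal range.  The crossover is NOT `14336`:
in the top sliver `[17/1152, 1/64)` of E4M3's subnormal band the element rounds UP to `2⁻⁶` with relative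
error `(1/64 − y)/y ≤ 1/17`, so the MX per-element atom `1/17` — hence the GEMM envelope `35/289` —
survives up to `κ ≤ θ := 258048/17 = 224·1024·18/(16·17) ≈ 15179.3` (`mxCeil_rel_error_le_sliver`,
`row_P5_mxCeil_le_vecE4M3`: still a TIE with per-vector E4M3), while for every `θ < κ ≤ 28672` the masked
two-sided block `(M, 0, v, …) · (0, M, v, …)` with `M = 224 + μ`, `v = (136/9 − μ)/1024 ↦ 1/64` has
relative GEMM error `(256 − t²)/t² > 35/289` (`t = 1024·v`), so `MXC ⋠ VEC-E4M3` (`row_P5_fails_above`);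
`VEC-E4M3 ≼ MXC` holds throughout (`row_P2_vecE4M3_le_mxCeil`, `κ ≤ 28672`).  This masked witness needs
blocks of length `≥ 3`; for length `2` the one-sided mask `(M, v) · (0, w)` gives the same crossover `θ`
(`GemmEnvelopeRowP5Two`), and for length `1` the tie persists for every `κ` (`row_P5_one_mxCeil_le_vecE4M3`).
Witness numbers (incl. the attained `31/225` at the tie `t = 15`) reproduced with 0 diff by both pipelines:
`certs/gemm/GEMM-ENVELOPES-P5.json`. [cite: RouhaniEtAl2023MX, §5.1, §6.1]; [cite: MicikeviciusEtAl2022, §3]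
-/

namespace Summit.Ventures.CertifiedArithmetic.LowPrec.GemmEnvelope

open Finset
open Literature.ComputerArithmetic.FloatingPoint
open Literature.ComputerArithmetic.FloatingPoint.Format
open Literature.ComputerArithmetic.FloatingPoint.MiniFloat
open Literature.ComputerArithmetic.FloatingPoint.MXBlock
open Summit.Ventures.CertifiedArithmetic.LowPrec.SR

/-! ## The top sliver of the subnormal band -/

/-- Every rational in `(15/1024, 1/64]` rounds to `1/64 = 2⁻⁶` (the smallest normal E4M3 value):
`15/1024` is the midpoint of the consecutive values `14/1024, 16/1024`. [folklore] -/
theorem toRat_roundNE_E4M3_eq_inv64 {y : ℚ} (h1 : 15 / 1024 < y) (h2 : y ≤ 1 / 64) :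
    (roundNE E4M3 y).toRat = 1 / 64 := by
  have hlo : (roundNE E4M3 (7 / 512)).toRat = 7 / 512 := by decide +kernel
  have hhi : (roundNE E4M3 (1 / 64)).toRat = 1 / 64 := by decide +kernel
  have hall : ((all E4M3).all fun z => decide (z.toRat ≤ 7 / 512 ∨ 1 / 64 ≤ z.toRat)) = true := by
    decide +kernel
  have hgap : ∀ z : MiniFloat E4M3,
      z.toRat ≤ (roundNE E4M3 (7 / 512)).toRat ∨ (roundNE E4M3 (7 / 512)).toRat + 1 / 512 ≤ z.toRat := by
    intro z
    have hz := of_decide_eq_true (forall_of_all_all hall z)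
    rw [hlo]
    rcases hz with hz | hz
    · exact Or.inl hz
    · exact Or.inr (by linarith)
  have hu : (roundNE E4M3 (1 / 64)).toRat = (roundNE E4M3 (7 / 512)).toRat + 1 / 512 := by
    rw [hlo, hhi]; norm_num
  have key := forall_lt_of_mem_high (x := y) hu hgap (by rw [hlo]; linarith) (by rw [hlo]; linarith)
  rw [hhi] at key
  exact toRat_roundNE_eq_of_forall_lt ⟨roundNE E4M3 (1 / 64), hhi⟩ key

/-- Sliver arithmetic: a positive element scaled into `(17/1152 · X, X/64)` is reproduced as `X/64` with
relative error at most `1/17` (`1/64 ≤ 18/17 · y` iff `y ≥ 17/1152`). [folklore] -/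
theorem sliver_rel_error_le {X v : ℚ} (hX : 0 < X) (h1 : 17 / 1152 * X < v) (h2 : v < 1 / 64 * X) :
    |X * (roundNE E4M3 (v / X)).toRat - v| ≤ 1 / 17 * v := by
  have hv : 0 < v := lt_trans (by positivity) h1
  have hr : (roundNE E4M3 (v / X)).toRat = 1 / 64 :=
    toRat_roundNE_E4M3_eq_inv64 (by rw [lt_div_iff₀ hX]; linarith) (by rw [div_le_iff₀ hX]; linarith)
  rw [hr, abs_of_nonneg (by linarith)]
  linarith

/-- MX CEIL RELATIVE ATOM INTO THE SLIVER (E4M3): on the class `Vᵢ = 0 ∨ blockMax V ≤ κ · |Vᵢ|` with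
`κ ≤ 258048/17` the ceil-scaled element — normal, or in the top sliver `[17/1152, 1/64)` of the subnormal
band because the ceil scale is minimal (`X · 448 < 2 · blockMax V`) — is reproduced with relative error
`≤ 1/17 = u/(1+u)`.  Sharp: the threshold `258048/17` is where `(1/64 − y)/y = 1/17`.
[cite: RouhaniEtAl2023MX, §3, §5.1] -/
theorem mxCeil_rel_error_le_sliver {k : ℕ} (V : Fin k → ℚ) (i : Fin k) {κ : ℚ}
    (hκ : V i = 0 ∨ blockMax V ≤ κ * |V i|) (hκM : κ ≤ 258048 / 17) :
    |ceilScale E4M3 V * (roundNE E4M3 (V i / ceilScale E4M3 V)).toRat - V i| ≤ 1 / 17 * |V i| := by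
  have hM : E4M3.maxRat = 448 := by decide +kernel
  have hM0 : 0 < E4M3.maxRat := by rw [hM]; norm_num
  by_cases hVi : V i = 0
  · rw [hVi, scaled_zero]; simp
  have hκ' : blockMax V ≤ κ * |V i| := hκ.resolve_left hVi
  have hpos : 0 < |V i| := abs_pos.mpr hVi
  have hX : 0 < ceilScale E4M3 V := ceilScale_pos E4M3 V
  have hB : 0 < blockMax V := lt_of_lt_of_le hpos (abs_le_blockMax V i)
  have hlt := ceilScale_mul_maxRat_lt_two_mul hM0 hB
  rw [hM] at hlt
  have h1 : κ * |V i| ≤ 258048 / 17 * |V i| := mul_le_mul_of_nonneg_right hκM hpos.le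
  have hy : 17 / 1152 * ceilScale E4M3 V < |V i| := by linarith
  by_cases hn : 1 / 64 ≤ |V i| / ceilScale E4M3 V
  · have h := scaled_rel_error_le E4M3 hX (by rw [e4m3_envelope_constants.2.2.2.2.1]; exact hn)
      (mxCeil_scaled_le_maxRat E4M3 V i hM0)
    rwa [e4m3_envelope_constants.1] at h
  · have h2 : |V i| < 1 / 64 * ceilScale E4M3 V := by
      have hn' := not_le.mp hn
      rwa [div_lt_iff₀ hX] at hn'
    have h := sliver_rel_error_le hX hy h2
    rcases lt_or_gt_of_ne hVi with hneg | hposv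
    · have e : V i / ceilScale E4M3 V = -(|V i| / ceilScale E4M3 V) := by
        rw [abs_of_neg hneg]; ring
      have e2 : ceilScale E4M3 V * -(roundNE E4M3 (|V i| / ceilScale E4M3 V)).toRat - V i
          = -(ceilScale E4M3 V * (roundNE E4M3 (|V i| / ceilScale E4M3 V)).toRat - |V i|) := by
        rw [abs_of_neg hneg]; ring
      rw [e, toRat_roundNE_neg, e2, abs_neg]
      exact h
    · rw [abs_of_pos hposv] at h ⊢
      exact h

/-- MX-E4M3 (ceil) GEMM envelope `35/289` extended to `κ ≤ 258048/17` (exact accumulation).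
[cite: RouhaniEtAl2023MX, §5.1] -/
theorem mxCeil_blocked_le_sliver {B k : ℕ} (a b : Fin B → Fin k → ℚ) {Aa Ab κ : ℚ}
    (hκ : κ ≤ 258048 / 17)
    (ha : ∀ j i, |a j i| ≤ Aa ∧ (a j i = 0 ∨ Aa ≤ κ * |a j i|))
    (hb : ∀ j i, |b j i| ≤ Ab ∧ (b j i = 0 ∨ Ab ≤ κ * |b j i|)) :
    |∑ j, ∑ i, (ceilScale E4M3 (a j) * (roundNE E4M3 (a j i / ceilScale E4M3 (a j))).toRat) *
        (ceilScale E4M3 (b j) * (roundNE E4M3 (b j i / ceilScale E4M3 (b j))).toRat)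
        - ∑ j, ∑ i, a j i * b j i| ≤ 35 / 289 * ∑ j, ∑ i, |a j i * b j i| := by
  have hca : ∀ j i, a j i = 0 ∨ blockMax (a j) ≤ κ * |a j i| := fun j i =>
    (ha j i).2.imp_right fun h => le_trans
      (blockMax_le_of_forall_le (le_trans (abs_nonneg _) (ha j i).1) fun i' => (ha j i').1) h
  have hcb : ∀ j i, b j i = 0 ∨ blockMax (b j) ≤ κ * |b j i| := fun j i =>
    (hb j i).2.imp_right fun h => le_trans
      (blockMax_le_of_forall_le (le_trans (abs_nonneg _) (hb j i).1) fun i' => (hb j i').1) h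
  have h := eDec_blocked a b
    (fun j i => ceilScale E4M3 (a j) * (roundNE E4M3 (a j i / ceilScale E4M3 (a j))).toRat)
    (fun j i => ceilScale E4M3 (b j) * (roundNE E4M3 (b j i / ceilScale E4M3 (b j))).toRat)
    (ua := 1 / 17) (ub := 1 / 17) (γ := 0) (δ := 0)
    (acc := ∑ j, ∑ i, (ceilScale E4M3 (a j) * (roundNE E4M3 (a j i / ceilScale E4M3 (a j))).toRat) *
        (ceilScale E4M3 (b j) * (roundNE E4M3 (b j i / ceilScale E4M3 (b j))).toRat))
    (c := ∑ j, ∑ i, (ceilScale E4M3 (a j) * (roundNE E4M3 (a j i / ceilScale E4M3 (a j))).toRat) *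
        (ceilScale E4M3 (b j) * (roundNE E4M3 (b j i / ceilScale E4M3 (b j))).toRat))
    le_rfl le_rfl (fun j i => mxCeil_rel_error_le_sliver (a j) i (hca j i) hκ)
    (fun j i => mxCeil_rel_error_le_sliver (b j) i (hcb j i) hκ) (by simp) (by simp)
  have e : ((1 : ℚ) / 17 + 1 / 17 + 1 / 17 * (1 / 17)) + 0 * (1 + (1 / 17 + 1 / 17 + 1 / 17 * (1 / 17)))
      + 0 * (1 + (1 / 17 + 1 / 17 + 1 / 17 * (1 / 17))) * (1 + 0) = 35 / 289 := by norm_num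
  rw [e] at h
  exact h

/-! ## Row P5 -/

/-- **ROW P5, `κ ≤ 258048/17`**: `MXC ≼ VEC-E4M3` STILL HOLDS on `C(κ)` for `2 ≤ κ ≤ 258048/17` — the tie of
row P2 extends past `14336` (with `row_P2_vecE4M3_le_mxCeil`, `κ ≤ 28672`, both inclusions hold).
[cite: MicikeviciusEtAl2022, §3] -/
theorem row_P5_mxCeil_le_vecE4M3 {B k : ℕ} (hB : 0 < B) (hk : 0 < k) {κ : ℚ} (hκ1 : 2 ≤ κ)
    (hκ2 : κ ≤ 258048 / 17) (q : ℚ)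
    (hY : ∀ (a b : Fin B → Fin k → ℚ) (Aa Ab : ℚ),
      (∀ j i, |a j i| ≤ Aa ∧ (a j i = 0 ∨ Aa ≤ κ * |a j i|)) →
      (∀ j i, |b j i| ≤ Ab ∧ (b j i = 0 ∨ Ab ≤ κ * |b j i|)) →
      |∑ j, ∑ i, (Aa / E4M3.maxRat * (roundNE E4M3 (a j i / (Aa / E4M3.maxRat))).toRat) *
          (Ab / E4M3.maxRat * (roundNE E4M3 (b j i / (Ab / E4M3.maxRat))).toRat)
          - ∑ j, ∑ i, a j i * b j i| ≤ q * ∑ j, ∑ i, |a j i * b j i|)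
    (a b : Fin B → Fin k → ℚ) (Aa Ab : ℚ)
    (ha : ∀ j i, |a j i| ≤ Aa ∧ (a j i = 0 ∨ Aa ≤ κ * |a j i|))
    (hb : ∀ j i, |b j i| ≤ Ab ∧ (b j i = 0 ∨ Ab ≤ κ * |b j i|)) :
    |∑ j, ∑ i, (ceilScale E4M3 (a j) * (roundNE E4M3 (a j i / ceilScale E4M3 (a j))).toRat) *
        (ceilScale E4M3 (b j) * (roundNE E4M3 (b j i / ceilScale E4M3 (b j))).toRat)
        - ∑ j, ∑ i, a j i * b j i| ≤ q * ∑ j, ∑ i, |a j i * b j i| := by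
  have hM : E4M3.maxRat = 448 := by decide +kernel
  have hq : 35 / 289 ≤ q := by
    refine le_of_forall_approach fun x hx1 hx2 => ?_
    have hx0 : 0 < x := by linarith
    have hmem : ∀ (j : Fin B) (i : Fin k), |(fun (_ : Fin B) (_ : Fin k) => x) j i| ≤ E4M3.maxRat ∧
        ((fun (_ : Fin B) (_ : Fin k) => x) j i = 0 ∨
          E4M3.maxRat ≤ κ * |(fun (_ : Fin B) (_ : Fin k) => x) j i|) := fun _ _ => by
      refine ⟨by rw [abs_of_pos hx0, hM]; linarith, Or.inr ?_⟩
      rw [abs_of_pos hx0, hM]; nlinarith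
    have hw := hY _ _ E4M3.maxRat E4M3.maxRat hmem hmem
    have hv : E4M3.maxRat / E4M3.maxRat * (roundNE E4M3 (x / (E4M3.maxRat / E4M3.maxRat))).toRat
        = 288 := by
      rw [div_self (by rw [hM]; norm_num), div_one, one_mul]
      exact toRat_roundNE_E4M3_eq_288 hx1 hx2.le
    simp only [hv] at hw
    exact (ratio_le_of_const_witness hB hk (mul_pos hx0 hx0) hw).1
  have hL : 0 ≤ ∑ j, ∑ i, |a j i * b j i| :=
    Finset.sum_nonneg fun j _ => Finset.sum_nonneg fun i _ => abs_nonneg _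
  exact le_trans (mxCeil_blocked_le_sliver a b hκ2 ha hb) (mul_le_mul_of_nonneg_right hq hL)

/-- **ROW P5, `κ > 258048/17`**: for `258048/17 < κ ≤ 28672` and blocks of length `≥ 3`, `MXC ≼ VEC-E4M3`
FAILS on `C(κ)`: the per-vector E4M3 datapath satisfies the uniform bound `35/289`, but the MX input with
blocks `a = (M, 0, v, …, v)`, `b = (0, M, v, …, v)`, `M = 224 + μ`, `v = (136/9 − μ)/1024`
(`μ = min (1/20) ((136 κ/9 − 229376)/(1024 + κ))`, numerators `M`) has block scale `1`, `v ↦ 1/64`, and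
relative GEMM error `(1/4096 − v²)/v² > 35/289`. [cite: RouhaniEtAl2023MX, §5.1, §6.1] -/
theorem row_P5_fails_above {B k : ℕ} (hB : 0 < B) (hk : 3 ≤ k) {κ : ℚ} (hκ1 : 258048 / 17 < κ)
    (hκ2 : κ ≤ 28672) :
    ∃ q : ℚ, (∀ (a b : Fin B → Fin k → ℚ) (Aa Ab : ℚ),
        (∀ j i, |a j i| ≤ Aa ∧ (a j i = 0 ∨ Aa ≤ κ * |a j i|)) →
        (∀ j i, |b j i| ≤ Ab ∧ (b j i = 0 ∨ Ab ≤ κ * |b j i|)) →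
        |∑ j, ∑ i, (Aa / E4M3.maxRat * (roundNE E4M3 (a j i / (Aa / E4M3.maxRat))).toRat) *
            (Ab / E4M3.maxRat * (roundNE E4M3 (b j i / (Ab / E4M3.maxRat))).toRat)
            - ∑ j, ∑ i, a j i * b j i| ≤ q * ∑ j, ∑ i, |a j i * b j i|) ∧
      ∃ (a b : Fin B → Fin k → ℚ) (Aa Ab : ℚ),
        (∀ j i, |a j i| ≤ Aa ∧ (a j i = 0 ∨ Aa ≤ κ * |a j i|)) ∧
        (∀ j i, |b j i| ≤ Ab ∧ (b j i = 0 ∨ Ab ≤ κ * |b j i|)) ∧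
        q * ∑ j, ∑ i, |a j i * b j i| <
        |∑ j, ∑ i, (ceilScale E4M3 (a j) * (roundNE E4M3 (a j i / ceilScale E4M3 (a j))).toRat) *
            (ceilScale E4M3 (b j) * (roundNE E4M3 (b j i / ceilScale E4M3 (b j))).toRat)
            - ∑ j, ∑ i, a j i * b j i| := by
  obtain ⟨n, rfl⟩ : ∃ n, k = n + 3 := ⟨k - 3, by omega⟩
  have hM0 : 0 < E4M3.maxRat := by rw [e4m3_envelope_constants.2.2.2.2.2.1]; norm_num
  refine ⟨35 / 289, fun a b Aa Ab ha hb => vecE4M3_blocked_le a b hκ2 ha hb, ?_⟩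
  -- the witness parameters
  set μ : ℚ := min (1 / 20) ((κ * (136 / 9) - 229376) / (1024 + κ)) with hμdef
  have hκ0 : 0 < 1024 + κ := by linarith
  have hμpos : 0 < μ := lt_min (by norm_num) (div_pos (by linarith) hκ0)
  have hμle : μ ≤ 1 / 20 := min_le_left _ _
  have hμκ : μ * (1024 + κ) ≤ κ * (136 / 9) - 229376 := by
    have := min_le_right (1 / 20 : ℚ) ((κ * (136 / 9) - 229376) / (1024 + κ))
    rwa [le_div_iff₀ hκ0] at this
  set M : ℚ := 224 + μ with hMdef
  set v : ℚ := (136 / 9 - μ) / 1024 with hvdef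
  have hMpos : 0 < M := by positivity
  have hv0 : 0 < v := by rw [hvdef]; apply div_pos _ (by norm_num); linarith
  have hv15 : 15 / 1024 < v := by rw [hvdef, lt_div_iff₀ (by norm_num : (0:ℚ) < 1024)]; linarith
  have hv16 : v ≤ 1 / 64 := by rw [hvdef, div_le_iff₀ (by norm_num : (0:ℚ) < 1024)]; linarith
  have hv17 : v < 17 / 1152 := by rw [hvdef, div_lt_iff₀ (by norm_num : (0:ℚ) < 1024)]; linarith
  have hvM : v ≤ M := by linarith
  have hκv : M ≤ κ * v := by
    rw [hvdef, hMdef]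
    have : (224 + μ) * 1024 ≤ κ * (136 / 9 - μ) := by nlinarith
    rw [mul_div_assoc', le_div_iff₀ (by norm_num : (0:ℚ) < 1024)]
    linarith
  have hκM : M ≤ κ * M := by nlinarith
  have h64 : (roundNE E4M3 v).toRat = 1 / 64 := toRat_roundNE_E4M3_eq_inv64 hv15 hv16
  -- the blocks
  set a' : Fin (n + 3) → ℚ := Fin.cases M (Fin.cases (0 : ℚ) (fun _ : Fin (n + 1) => v)) with ha'
  set b' : Fin (n + 3) → ℚ := Fin.cases (0 : ℚ) (Fin.cases M (fun _ : Fin (n + 1) => v)) with hb'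
  have ha0 : a' 0 = M := by rw [ha']; rfl
  have hb1 : b' 1 = M := by rw [hb']; rfl
  have haM : ∀ i, |a' i| ≤ M := by
    intro i; rw [ha']
    refine Fin.cases ?_ (fun i' => Fin.cases ?_ (fun _ => ?_) i') i
    · simp only [Fin.cases_zero]; rw [abs_of_pos hMpos]
    · simp only [Fin.cases_succ, Fin.cases_zero, abs_zero]; exact hMpos.le
    · simp only [Fin.cases_succ]; rwa [abs_of_pos hv0]
  have hbM : ∀ i, |b' i| ≤ M := by
    intro i; rw [hb']
    refine Fin.cases ?_ (fun i' => Fin.cases ?_ (fun _ => ?_) i') i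
    · simp only [Fin.cases_zero, abs_zero]; exact hMpos.le
    · simp only [Fin.cases_succ, Fin.cases_zero]; rw [abs_of_pos hMpos]
    · simp only [Fin.cases_succ]; rwa [abs_of_pos hv0]
  have hmemA : ∀ (j : Fin B) (i : Fin (n + 3)), |(fun _ : Fin B => a') j i| ≤ M ∧
      ((fun _ : Fin B => a') j i = 0 ∨ M ≤ κ * |(fun _ : Fin B => a') j i|) := by
    intro j i; refine ⟨haM i, ?_⟩
    show a' i = 0 ∨ M ≤ κ * |a' i|
    rw [ha']
    refine Fin.cases ?_ (fun i' => Fin.cases ?_ (fun _ => ?_) i') i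
    · simp only [Fin.cases_zero]; rw [abs_of_pos hMpos]; exact Or.inr hκM
    · simp only [Fin.cases_succ, Fin.cases_zero]
      first | exact Or.inl rfl | exact Or.inl trivial
    · simp only [Fin.cases_succ]; rw [abs_of_pos hv0]; exact Or.inr hκv
  have hmemB : ∀ (j : Fin B) (i : Fin (n + 3)), |(fun _ : Fin B => b') j i| ≤ M ∧
      ((fun _ : Fin B => b') j i = 0 ∨ M ≤ κ * |(fun _ : Fin B => b') j i|) := by
    intro j i; refine ⟨hbM i, ?_⟩
    show b' i = 0 ∨ M ≤ κ * |b' i|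
    rw [hb']
    refine Fin.cases ?_ (fun i' => Fin.cases ?_ (fun _ => ?_) i') i
    · simp only [Fin.cases_zero]
      first | exact Or.inl rfl | exact Or.inl trivial
    · simp only [Fin.cases_succ, Fin.cases_zero]; rw [abs_of_pos hMpos]; exact Or.inr hκM
    · simp only [Fin.cases_succ]; rw [abs_of_pos hv0]; exact Or.inr hκv
  -- scales
  have hXa : ceilScale E4M3 a' = 1 := by
    have hBM : blockMax a' = M := blockMax_eq_of_forall_le haM (i₀ := 0) (by rw [ha0, abs_of_pos hMpos])
    have h := ceilScale_eq_zpow hM0 (V := a') (e := 0)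
      (by rw [hBM, e4m3_envelope_constants.2.2.2.2.2.1]; norm_num; linarith)
      (by rw [hBM, e4m3_envelope_constants.2.2.2.2.2.1]; norm_num; linarith)
    simpa using h
  have hXb : ceilScale E4M3 b' = 1 := by
    have hBM : blockMax b' = M := blockMax_eq_of_forall_le hbM (i₀ := 1) (by rw [hb1, abs_of_pos hMpos])
    have h := ceilScale_eq_zpow hM0 (V := b') (e := 0)
      (by rw [hBM, e4m3_envelope_constants.2.2.2.2.2.1]; norm_num; linarith)
      (by rw [hBM, e4m3_envelope_constants.2.2.2.2.2.1]; norm_num; linarith)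
    simpa using h
  -- the three block sums
  have hS1 : ∑ i, (roundNE E4M3 (a' i)).toRat * (roundNE E4M3 (b' i)).toRat
      = ((n + 1 : ℕ) : ℚ) * (1 / 64 * (1 / 64)) := by
    rw [Fin.sum_univ_succ, Fin.sum_univ_succ, ha', hb']
    simp only [Fin.cases_zero, Fin.cases_succ, h64, toRat_roundNE_zero, mul_zero, zero_mul, zero_add,
      sum_const, card_univ, Fintype.card_fin, nsmul_eq_mul]
  have hS2 : ∑ i, a' i * b' i = ((n + 1 : ℕ) : ℚ) * (v * v) := by
    rw [Fin.sum_univ_succ, Fin.sum_univ_succ, ha', hb']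
    simp only [Fin.cases_zero, Fin.cases_succ, mul_zero, zero_mul, zero_add, sum_const, card_univ,
      Fintype.card_fin, nsmul_eq_mul]
  have hS3 : ∑ i, |a' i * b' i| = ((n + 1 : ℕ) : ℚ) * (v * v) := by
    rw [Fin.sum_univ_succ, Fin.sum_univ_succ, ha', hb']
    simp only [Fin.cases_zero, Fin.cases_succ, mul_zero, zero_mul, abs_zero, zero_add, sum_const,
      card_univ, Fintype.card_fin, nsmul_eq_mul, abs_of_pos (mul_pos hv0 hv0)]
  refine ⟨fun _ => a', fun _ => b', M, M, hmemA, hmemB, ?_⟩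
  simp only [hXa, hXb, div_one, one_mul, hS1, hS2, hS3, sum_const, card_univ, Fintype.card_fin,
    nsmul_eq_mul]
  have hBn : (0 : ℚ) < (B : ℚ) * ((n + 1 : ℕ) : ℚ) := by
    have : (0 : ℚ) < (B : ℚ) := by exact_mod_cast hB
    positivity
  have hvv : v * v < 289 / 1327104 := by nlinarith
  have hcore : 35 / 289 * (v * v) < 1 / 64 * (1 / 64) - v * v := by linarith
  rw [abs_of_pos (by nlinarith [mul_lt_mul_of_pos_left hcore hBn])]
  nlinarith [mul_lt_mul_of_pos_left hcore hBn]

/-! ### Blocks of length 1: the tie persists for every `κ` -/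

/-- For blocks of length `1` the ceil-scaled MX element is the block maximum itself (scaled into
`(224, 448]`, never subnormal): the MX envelope is `35/289` for EVERY `κ`. [cite: RouhaniEtAl2023MX, §5.1] -/
theorem mxCeil_blocked_le_one {B : ℕ} (a b : Fin B → Fin 1 → ℚ) :
    |∑ j, ∑ i, (ceilScale E4M3 (a j) * (roundNE E4M3 (a j i / ceilScale E4M3 (a j))).toRat) *
        (ceilScale E4M3 (b j) * (roundNE E4M3 (b j i / ceilScale E4M3 (b j))).toRat)
        - ∑ j, ∑ i, a j i * b j i| ≤ 35 / 289 * ∑ j, ∑ i, |a j i * b j i| := by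
  have hbm : ∀ (V : Fin 1 → ℚ) (i : Fin 1), V i = 0 ∨ blockMax V ≤ 1 * |V i| := fun V i =>
    Or.inr (by
      rw [one_mul]
      exact blockMax_le_of_forall_le (abs_nonneg _) fun i' => by rw [Subsingleton.elim i' i])
  have h := gemm_mxCeil_envelope_E4M3 a b
    (fun j i => ceilScale E4M3 (a j) * (roundNE E4M3 (a j i / ceilScale E4M3 (a j))).toRat)
    (fun j i => ceilScale E4M3 (b j) * (roundNE E4M3 (b j i / ceilScale E4M3 (b j))).toRat)
    (γ := 0) (δ := 0)
    (acc := ∑ j, ∑ i, (ceilScale E4M3 (a j) * (roundNE E4M3 (a j i / ceilScale E4M3 (a j))).toRat) *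
        (ceilScale E4M3 (b j) * (roundNE E4M3 (b j i / ceilScale E4M3 (b j))).toRat))
    (c := ∑ j, ∑ i, (ceilScale E4M3 (a j) * (roundNE E4M3 (a j i / ceilScale E4M3 (a j))).toRat) *
        (ceilScale E4M3 (b j) * (roundNE E4M3 (b j i / ceilScale E4M3 (b j))).toRat))
    le_rfl le_rfl (by norm_num : (1 : ℚ) ≤ 14336) (fun j i => hbm (a j) i) (fun j i => hbm (b j) i)
    (fun _ _ => rfl) (fun _ _ => rfl) (by simp) (by simp)
  simp only [zero_mul, add_zero] at h
  exact h

/-- **ROW P5 for blocks of length 1**: `MXC ≼ VEC-E4M3` on `C(κ)` for EVERY `κ ≥ 2` (no upper limit on the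
MX side); with `row_P2_vecE4M3_le_mxCeil` (`κ ≤ 28672`) the tie persists through the whole P5 regime.
(For every `k ≥ 2` the crossover is `258048/17`: `row_P5_fails_above` for `k ≥ 3`,
`GemmEnvelopeRowP5Two.row_P5_two_fails_above` for `k = 2`.) [cite: RouhaniEtAl2023MX, §5.1]; [cite: MicikeviciusEtAl2022, §3] -/
theorem row_P5_one_mxCeil_le_vecE4M3 {B : ℕ} (hB : 0 < B) {κ : ℚ} (hκ1 : 2 ≤ κ) (q : ℚ)
    (hY : ∀ (a b : Fin B → Fin 1 → ℚ) (Aa Ab : ℚ),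
      (∀ j i, |a j i| ≤ Aa ∧ (a j i = 0 ∨ Aa ≤ κ * |a j i|)) →
      (∀ j i, |b j i| ≤ Ab ∧ (b j i = 0 ∨ Ab ≤ κ * |b j i|)) →
      |∑ j, ∑ i, (Aa / E4M3.maxRat * (roundNE E4M3 (a j i / (Aa / E4M3.maxRat))).toRat) *
          (Ab / E4M3.maxRat * (roundNE E4M3 (b j i / (Ab / E4M3.maxRat))).toRat)
          - ∑ j, ∑ i, a j i * b j i| ≤ q * ∑ j, ∑ i, |a j i * b j i|)
    (a b : Fin B → Fin 1 → ℚ) :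
    |∑ j, ∑ i, (ceilScale E4M3 (a j) * (roundNE E4M3 (a j i / ceilScale E4M3 (a j))).toRat) *
        (ceilScale E4M3 (b j) * (roundNE E4M3 (b j i / ceilScale E4M3 (b j))).toRat)
        - ∑ j, ∑ i, a j i * b j i| ≤ q * ∑ j, ∑ i, |a j i * b j i| := by
  have hM : E4M3.maxRat = 448 := by decide +kernel
  have hq : 35 / 289 ≤ q := by
    refine le_of_forall_approach fun x hx1 hx2 => ?_
    have hx0 : 0 < x := by linarith
    have hmem : ∀ (j : Fin B) (i : Fin 1), |(fun (_ : Fin B) (_ : Fin 1) => x) j i| ≤ E4M3.maxRat ∧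
        ((fun (_ : Fin B) (_ : Fin 1) => x) j i = 0 ∨
          E4M3.maxRat ≤ κ * |(fun (_ : Fin B) (_ : Fin 1) => x) j i|) := fun _ _ => by
      refine ⟨by rw [abs_of_pos hx0, hM]; linarith, Or.inr ?_⟩
      rw [abs_of_pos hx0, hM]; nlinarith
    have hw := hY _ _ E4M3.maxRat E4M3.maxRat hmem hmem
    have hv : E4M3.maxRat / E4M3.maxRat * (roundNE E4M3 (x / (E4M3.maxRat / E4M3.maxRat))).toRat
        = 288 := by
      rw [div_self (by rw [hM]; norm_num), div_one, one_mul]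
      exact toRat_roundNE_E4M3_eq_288 hx1 hx2.le
    simp only [hv] at hw
    exact (ratio_le_of_const_witness hB one_pos (mul_pos hx0 hx0) hw).1
  have hL : 0 ≤ ∑ j, ∑ i, |a j i * b j i| :=
    Finset.sum_nonneg fun j _ => Finset.sum_nonneg fun i _ => abs_nonneg _
  exact le_trans (mxCeil_blocked_le_one a b) (mul_le_mul_of_nonneg_right hq hL)

end Summit.Ventures.CertifiedArithmetic.LowPrec.GemmEnvelope
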